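import Summits.BirchSwinnertonDyer.BirchSwinnertonDyer.Theses.PAdicOrderV2
import Summits.BirchSwinnertonDyer.BirchSwinnertonDyer.Theses.LeadingTerm
import Summits.BirchSwinnertonDyer.BirchSwinnertonDyer.Theorems.LeadingTermLBOfCruxes
import Literature.NumberTheory.EllipticCurves.CanonicalPAdicHeightHolds

/-!
# BirchSwinnertonDyer / PAdicOrderV2 — crux `PAdicOrderThesisR2` (stmt-0487), line `Sketch`:
# the crux and its open stubs against the sibling route LeadingTerm (`PinchPrime`, `Consistency`)

Route LeadingTerm (opened 2026-08-16) carries, as its crux #3 `PinchPrime` (stmt-BirchSwinnertonDyer-16218),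
the MORDELL–WEIL-SIDE one-prime conjunct of `X = PAdicOrderThesisR2`: every `E/ℚ` (globally minimal `W`)
has a good ordinary prime `p ≥ 5` (with a canonical cyclotomic height datum `D`, a free witness by
`WeierstrassCurve.exists_isCanonical_holds`) and a newform `f` with `ord_{T=0} L_p(f, α_p, T) = r_MW(E)`.
This file places `X` and the open stubs of line `Sketch` against the LeadingTerm items, sorry-free:

* `padicOrderThesisR2_of_pinchPrime_of_bsd` — `X ⟸ PinchPrime ∧ BSD-rank(gm)`; PinchPrime's `∃ f`
  discharges the modularity debt of `X` (compare `padicOrderThesisR2_of_padicBSDrank_of_bsd`, which needs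
  modularity inlined, and the disprover's `thesis_iff_bsd_and_onePrime`).
* `padicOrderThesisR2_of_leadingTerm` — `X ⟸ Consistency ∧ PinchPrime ∧ SqueezeUBR2`: the crux set of
  route LeadingTerm settles this route's thesis outright (through LeadingTerm's certified `closes`).
* `analyticRank_le_mordellWeilRank_of_iteratedDeriv_ne_zero` — the junk-robust step
  `L^{(r_MW)}(E,1) ≠ 0 ⇒ r_an ≤ r_MW` (as inside `LeadingTerm.closes`), and hence
  `analyticRank_le_mordellWeilRank_of_leadingTerm` — the full BSD lower bound from
  `Consistency ∧ PinchPrime` (via the closed support `LBOfCruxes`, `leadingTerm_lbOfCruxes_proof`) — and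
  the registered lower-bound stubs `stub_LB_ge2_of_leadingTerm`, `stub_LB_rank1_of_leadingTerm`
  (a third item-level source of `stub_LB_ge2`, next to `HigherGZConstructionR2` and Squeeze #3 ∧ #5).
* `exists_onePrimeUB_of_pinchPrime_of_UB` — the `∃f`-form of the one-prime upper bound `stub_UB_pos`
  from `PinchPrime ∧ SqueezeUBR2` (`ord = r_MW ≤ r_an` at the pinch prime).
* `pinchPrime_of_stubs` — conversely, the sandwich stubs of line `Sketch` (Kato side, `stub_UB_pos`, the
  BSD lower bound) plus modularity give `PinchPrime`: at the witness prime of `stub_UB_pos`,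
  `r_MW ≤ ord ≤ r_an ≤ r_MW`. So modulo BSD-rank and Kato the two one-prime cruxes (analytic-side
  `stub_UB_pos`, Mordell–Weil-side `PinchPrime`) are one statement.
* `thesisFiveLe_iff_bsd_and_pinchPrime` — NORMAL FORM: `X₅` (`X` with its witness prime `≥ 5`, stated
  inline) is LITERALLY `BSD-rank(gm) ∧ PinchPrime`; `padicOrderThesisR2_of_thesisFiveLe : X₅ → X`; and
  `exists_order_eq_mordellWeilRank_of_thesis : X →` the datum-free, bound-free pinch.

Nothing here is asserted unconditionally about `X`; every LeadingTerm crux enters as an explicit hypothesis.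
-/

-- single-conjunct summit: `Summit.BirchSwinnertonDyer.BirchSwinnertonDyer.…` repeats the name by design
set_option linter.dupNamespace false

namespace Summit.BirchSwinnertonDyer.BirchSwinnertonDyer.Cruxes.PAdicOrderThesisR2.KatoSandwich

open scoped MatrixGroups ModularForm
open CongruenceSubgroup
open Literature.NumberTheory.EllipticCurves Literature.NumberTheory.EllipticCurves.ModularForms
open Summit.BirchSwinnertonDyer.BirchSwinnertonDyer.Theses

/-! ## `X` from `PinchPrime` -/

/-- **`X ⟸ PinchPrime ∧ BSD-rank(gm).`** If every `E/ℚ` (globally minimal `W`) has a pinch prime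
(`LeadingTerm.PinchPrime`, stmt-16218: a good ordinary `p ≥ 5`, a canonical height datum and a newform `f`
with `ord_{T=0} L_p(f, α_p, T) = r_MW`) and `r_an = r_MW` for globally minimal models, then `X`: at the pinch
prime `ord = r_MW = r_an`. The newform of `X` is the one PinchPrime carries — no modularity hypothesis.
[cite: MazurTateTeitelbaum1986Invent, §II.10] -/
theorem padicOrderThesisR2_of_pinchPrime_of_bsd (hP : LeadingTerm.PinchPrime)
    (hBSD : ∀ (W : WeierstrassCurve ℚ) [W.IsElliptic] [W.IsGloballyMinimal],
      W.analyticRank = W.mordellWeilRank) :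
    PAdicOrderV2.PAdicOrderThesisR2 := by
  intro W _ _
  obtain ⟨p, hp, -, hord, -, -, N, hN, f, hf, horder⟩ := hP W
  refine ⟨p, hp, hord, N, hN, f, hf, ?_, horder⟩
  rw [horder, hBSD W]

/-- **`X ⟸ Consistency ∧ PinchPrime ∧ SqueezeUBR2`**: the three cruxes of route LeadingTerm imply the
thesis `X` of route PAdicOrderV2 — BSD-rank is LeadingTerm's certified deciding theorem `LeadingTerm.closes`,
and then `padicOrderThesisR2_of_pinchPrime_of_bsd`. [cite: MazurTateTeitelbaum1986Invent, §II.10] -/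
theorem padicOrderThesisR2_of_leadingTerm (hC : LeadingTerm.Consistency) (hP : LeadingTerm.PinchPrime)
    (hUB : LeadingTerm.SqueezeUBR2) : PAdicOrderV2.PAdicOrderThesisR2 :=
  padicOrderThesisR2_of_pinchPrime_of_bsd hP fun W _ _ ↦ LeadingTerm.closes hC hP hUB W ‹_›

/-! ## The lower-bound stubs from `Consistency ∧ PinchPrime` -/

/-- **`L^{(r_MW)}(E,1) ≠ 0 ⇒ r_an ≤ r_MW`** (junk-robust, exactly as inside `LeadingTerm.closes`): if
`r_an > r_MW` then `r_an ≥ 1` forces `L(E,s)` to be analytic at `s = 1` of finite order `r_an`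
(`analyticOrderNatAt_of_not_analyticAt`, `Nat.cast_analyticOrderNatAt`), and
`natCast_le_analyticOrderAt_iff_iteratedDeriv_eq_zero` makes the `r_MW`-th derivative vanish. [folklore] -/
theorem analyticRank_le_mordellWeilRank_of_iteratedDeriv_ne_zero (W : WeierstrassCurve ℚ) [W.IsElliptic]
    (hder : iteratedDeriv W.mordellWeilRank W.entireLFunction 1 ≠ 0) :
    W.analyticRank ≤ W.mordellWeilRank := by
  by_contra hlt
  push Not at hlt
  have han : AnalyticAt ℂ W.entireLFunction 1 := by
    by_contra h
    have : W.analyticRank = 0 := by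
      unfold WeierstrassCurve.analyticRank
      exact analyticOrderNatAt_of_not_analyticAt h
    omega
  have htop : analyticOrderAt W.entireLFunction 1 ≠ ⊤ := by
    intro h
    have : W.analyticRank = 0 := by
      unfold WeierstrassCurve.analyticRank analyticOrderNatAt
      rw [h]; rfl
    omega
  have hcast : ((W.analyticRank : ℕ) : ℕ∞) = analyticOrderAt W.entireLFunction 1 := by
    unfold WeierstrassCurve.analyticRank
    exact Nat.cast_analyticOrderNatAt htop
  exact hder ((natCast_le_analyticOrderAt_iff_iteratedDeriv_eq_zero han).mp hcast.le
    W.mordellWeilRank hlt)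

/-- **BSD lower bound from `Consistency ∧ PinchPrime`** (route LeadingTerm's `LB_∞`): for every elliptic
`W/ℚ`, `r_an(W) ≤ r_MW(W)` — the closed support `LBOfCruxes` (stmt-15623,
`Theorems.leadingTerm_lbOfCruxes_proof`: `L^{(r_MW)}(W,1) ≠ 0`) and
`analyticRank_le_mordellWeilRank_of_iteratedDeriv_ne_zero`. [cite: MazurTateTeitelbaum1986Invent, §II.10] -/
theorem analyticRank_le_mordellWeilRank_of_leadingTerm (hC : LeadingTerm.Consistency)
    (hP : LeadingTerm.PinchPrime) (W : WeierstrassCurve ℚ) [W.IsElliptic] :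
    W.analyticRank ≤ W.mordellWeilRank :=
  analyticRank_le_mordellWeilRank_of_iteratedDeriv_ne_zero W
    (Theorems.leadingTerm_lbOfCruxes_proof hC hP W)

/-- **`stub_LB_ge2` from `Consistency ∧ PinchPrime`** (registered signature of the skeleton stub as the
conclusion; neither `2 ≤ r_an` nor minimality is used). [folklore] -/
theorem stub_LB_ge2_of_leadingTerm :
    LeadingTerm.Consistency → LeadingTerm.PinchPrime →
    ∀ (W : WeierstrassCurve ℚ) [W.IsElliptic] [W.IsGloballyMinimal],
      2 ≤ W.analyticRank → W.analyticRank ≤ W.mordellWeilRank :=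
  fun hC hP W _ _ _ ↦ analyticRank_le_mordellWeilRank_of_leadingTerm hC hP W

/-- **`stub_LB_rank1` from `Consistency ∧ PinchPrime`** (registered signature of the skeleton stub as the
conclusion). [folklore] -/
theorem stub_LB_rank1_of_leadingTerm :
    LeadingTerm.Consistency → LeadingTerm.PinchPrime →
    ∀ (W : WeierstrassCurve ℚ) [W.IsElliptic] [W.IsGloballyMinimal],
      W.analyticRank = 1 → 1 ≤ W.mordellWeilRank := by
  intro hC hP W _ _ h1
  rw [← h1]
  exact analyticRank_le_mordellWeilRank_of_leadingTerm hC hP W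

/-! ## The one-prime upper bound and `PinchPrime`: one statement modulo BSD-rank and Kato -/

/-- **One-prime upper bound (`∃f`-form of `stub_UB_pos`) from `PinchPrime ∧ SqueezeUBR2`.** If every
`E/ℚ` (globally minimal `W`) has a pinch prime and `r_MW ≤ r_an` for every elliptic `W/ℚ`
(`LeadingTerm.SqueezeUBR2`, stmt-0145), then every such `E` has a good ordinary `p ≥ 5` and a newform `f`
with `ord_{T=0} L_p(f, α_p, T) ≤ r_an(E)` (`ord = r_MW ≤ r_an`). This is the `∃f`-packaging of the
registered stub `stub_UB_pos` (which asks the bound of EVERY newform of `E` at the witness prime; the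
two agree for the conductor-level newform by `IsNewformOf.unique`). [folklore] -/
theorem exists_onePrimeUB_of_pinchPrime_of_UB (hP : LeadingTerm.PinchPrime)
    (hUB : LeadingTerm.SqueezeUBR2) (W : WeierstrassCurve ℚ) [W.IsElliptic] [W.IsGloballyMinimal] :
    ∃ (p : ℕ) (_ : Fact p.Prime), 5 ≤ p ∧ IsOrdinaryAt W p ∧
      ∃ (N : ℕ) (_ : NeZero N) (f : CuspForm (Gamma0 N) 2), IsNewformOf W f ∧
        (padicLFunction f (unitRoot W p : ℚ_[p])).order ≤ (W.analyticRank : ℕ∞) := by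
  obtain ⟨p, hp, h5, hord, -, -, N, hN, f, hf, horder⟩ := hP W
  refine ⟨p, hp, h5, hord, N, hN, f, hf, ?_⟩
  rw [horder]
  exact_mod_cast hUB W

/-- **`PinchPrime` from the sandwich stubs of line `Sketch` plus modularity.** Suppose the Kato side
(`PAdicOrderKatoSideR2`, stmt-0491: `r_MW ≤ ord` at odd good ordinary `p`), the registered one-prime upper
bound `stub_UB_pos` (`∃` good ordinary `p ≥ 5`, `∀` newform `f`, `ord ≤ r_an` in positive analytic rank),
the rank-0 window (`stub_UB_rank0`, PROVED: `ord = 0` when `r_an = 0`), the BSD lower bound for globally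
minimal models and modularity (inlined as in `CruxesToThesis`) all hold. Then `LeadingTerm.PinchPrime`:
in analytic rank `0` any good ordinary `p ≥ 5` (`exists_good_ordinary_prime_holds`) has `ord = 0 = r_MW`
(Kato: `r_MW ≤ 0`); in positive rank the witness prime of `stub_UB_pos` has `r_MW ≤ ord ≤ r_an ≤ r_MW`;
the canonical height datum exists at every good ordinary `p ≥ 5` (`exists_isCanonical_holds`). So, modulo
BSD-rank and Kato, the analytic-side one-prime crux of this line and LeadingTerm's `PinchPrime` coincide.
[cite: MazurTateTeitelbaum1986Invent, §II.10] -/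
theorem pinchPrime_of_stubs (hK : PAdicOrderV2.PAdicOrderKatoSideR2)
    (hUB0 : ∀ (W : WeierstrassCurve ℚ) [W.IsElliptic] [W.IsGloballyMinimal] (p : ℕ) [Fact p.Prime],
      IsOrdinaryAt W p → W.analyticRank = 0 →
      ∀ {N : ℕ} [NeZero N] (f : CuspForm (Gamma0 N) 2), IsNewformOf W f →
        (padicLFunction f (unitRoot W p : ℚ_[p])).order = 0)
    (hUBpos : ∀ (W : WeierstrassCurve ℚ) [W.IsElliptic] [W.IsGloballyMinimal], 0 < W.analyticRank →
      ∃ (p : ℕ) (_ : Fact p.Prime), 5 ≤ p ∧ IsOrdinaryAt W p ∧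
        ∀ {N : ℕ} [NeZero N] (f : CuspForm (Gamma0 N) 2), IsNewformOf W f →
          (padicLFunction f (unitRoot W p : ℚ_[p])).order ≤ (W.analyticRank : ℕ∞))
    (hLB : ∀ (W : WeierstrassCurve ℚ) [W.IsElliptic] [W.IsGloballyMinimal],
      W.analyticRank ≤ W.mordellWeilRank)
    (hmod : ∀ (W : WeierstrassCurve ℚ) [W.IsElliptic] [NeZero (W.conductorNorm ℤ)],
      ∃ f : CuspForm (Gamma0 (W.conductorNorm ℤ)) 2, IsNewformOf W f) :
    LeadingTerm.PinchPrime := by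
  intro W _ _
  haveI hN : NeZero (W.conductorNorm ℤ) := ⟨(W.conductorNorm_pos_holds).ne'⟩
  obtain ⟨f, hf⟩ := hmod W
  rcases Nat.eq_zero_or_pos W.analyticRank with h0 | hpos
  · obtain ⟨p, hp, h5, hgood, hord⟩ := WeierstrassCurve.exists_good_ordinary_prime_holds W
    obtain ⟨D, hD⟩ := WeierstrassCurve.exists_isCanonical_holds W p h5 hgood hord
    have hO : IsOrdinaryAt W p := ⟨hgood, hord⟩
    have hub : (padicLFunction f (unitRoot W p : ℚ_[p])).order = 0 := hUB0 W p hO h0 f hf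
    have hk : (W.mordellWeilRank : ℕ∞) ≤ (padicLFunction f (unitRoot W p : ℚ_[p])).order :=
      hK W p (by omega) hO f hf
    refine ⟨p, hp, h5, hO, D, hD, W.conductorNorm ℤ, hN, f, hf, le_antisymm ?_ hk⟩
    rw [hub]
    exact zero_le
  · obtain ⟨p, hp, h5, hO, hub⟩ := hUBpos W hpos
    obtain ⟨D, hD⟩ := WeierstrassCurve.exists_isCanonical_holds W p h5 hO.1 hO.2
    have h1 : (W.mordellWeilRank : ℕ∞) ≤ (padicLFunction f (unitRoot W p : ℚ_[p])).order :=
      hK W p (by omega) hO f hf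
    have h2 : (padicLFunction f (unitRoot W p : ℚ_[p])).order ≤ (W.analyticRank : ℕ∞) := hub f hf
    have h3 : (W.analyticRank : ℕ∞) ≤ (W.mordellWeilRank : ℕ∞) := by exact_mod_cast hLB W
    exact ⟨p, hp, h5, hO, D, hD, W.conductorNorm ℤ, hN, f, hf, le_antisymm (h2.trans h3) h1⟩

/-! ## Normal form: `X` with its prime `≥ 5` is `BSD-rank(gm) ∧ PinchPrime` -/

/-- **`X →` the bound-free, datum-free pinch**: if `X` holds then every `E/ℚ` (globally minimal `W`) has a
good ordinary prime `p` and a newform `f` with `ord_{T=0} L_p(f, α_p, T) = r_MW(E)` — `PinchPrime` up to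
its conjunct `5 ≤ p` and its height-datum witness (which exists at every good ordinary `p ≥ 5`,
`exists_isCanonical_holds`, but not at `p ∈ {2, 3}` in the tree). [folklore] -/
theorem exists_order_eq_mordellWeilRank_of_thesis (hX : PAdicOrderV2.PAdicOrderThesisR2)
    (W : WeierstrassCurve ℚ) [W.IsElliptic] [W.IsGloballyMinimal] :
    ∃ (p : ℕ) (_ : Fact p.Prime), IsOrdinaryAt W p ∧
      ∃ (N : ℕ) (_ : NeZero N) (f : CuspForm (Gamma0 N) 2), IsNewformOf W f ∧
        (padicLFunction f (unitRoot W p : ℚ_[p])).order = W.mordellWeilRank := by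
  obtain ⟨p, hp, hord, N, hN, f, hf, -, hmw⟩ := hX W
  exact ⟨p, hp, hord, N, hN, f, hf, hmw⟩

/-- **Normal form.** The strengthening `X₅` of `X` in which the witness prime is `≥ 5` (stated inline,
`∃f`-packaged exactly as `X`) is EQUIVALENT to `BSD-rank(gm) ∧ LeadingTerm.PinchPrime`: `→` reads off
`r_an = r_MW` from the two equalities (`Nat.cast` injective) and supplies PinchPrime's canonical height
datum by `exists_isCanonical_holds` (Mazur–Tate / Schneider σ-height at good ordinary `p ≥ 5`); `←` is
`padicOrderThesisR2_of_pinchPrime_of_bsd` keeping `5 ≤ p`. So LeadingTerm's `PinchPrime` is exactly the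
Mordell–Weil-side one-prime conjunct of (this form of) the thesis of route PAdicOrderV2.
[cite: MazurTateTeitelbaum1986Invent, §II.10] -/
theorem thesisFiveLe_iff_bsd_and_pinchPrime :
    (∀ (W : WeierstrassCurve ℚ) [W.IsElliptic] [W.IsGloballyMinimal],
      ∃ (p : ℕ) (_ : Fact p.Prime), 5 ≤ p ∧ IsOrdinaryAt W p ∧
        ∃ (N : ℕ) (_ : NeZero N) (f : CuspForm (Gamma0 N) 2), IsNewformOf W f ∧
          (padicLFunction f (unitRoot W p : ℚ_[p])).order = W.analyticRank ∧
          (padicLFunction f (unitRoot W p : ℚ_[p])).order = W.mordellWeilRank) ↔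
    (∀ (W : WeierstrassCurve ℚ) [W.IsElliptic] [W.IsGloballyMinimal],
      W.analyticRank = W.mordellWeilRank) ∧ LeadingTerm.PinchPrime := by
  constructor
  · intro hX
    refine ⟨fun W _ _ ↦ ?_, fun W _ _ ↦ ?_⟩
    · obtain ⟨p, hp, -, -, N, hN, f, -, han, hmw⟩ := hX W
      exact_mod_cast han.symm.trans hmw
    · obtain ⟨p, hp, h5, hord, N, hN, f, hf, -, hmw⟩ := hX W
      obtain ⟨D, hD⟩ := WeierstrassCurve.exists_isCanonical_holds W p h5 hord.1 hord.2
      exact ⟨p, hp, h5, hord, D, hD, N, hN, f, hf, hmw⟩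
  · rintro ⟨hBSD, hP⟩ W _ _
    obtain ⟨p, hp, h5, hord, -, -, N, hN, f, hf, horder⟩ := hP W
    refine ⟨p, hp, h5, hord, N, hN, f, hf, ?_, horder⟩
    rw [horder, hBSD W]

/-- `X₅ → X` (forget `5 ≤ p`). [folklore] -/
theorem padicOrderThesisR2_of_thesisFiveLe
    (hX : ∀ (W : WeierstrassCurve ℚ) [W.IsElliptic] [W.IsGloballyMinimal],
      ∃ (p : ℕ) (_ : Fact p.Prime), 5 ≤ p ∧ IsOrdinaryAt W p ∧
        ∃ (N : ℕ) (_ : NeZero N) (f : CuspForm (Gamma0 N) 2), IsNewformOf W f ∧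
          (padicLFunction f (unitRoot W p : ℚ_[p])).order = W.analyticRank ∧
          (padicLFunction f (unitRoot W p : ℚ_[p])).order = W.mordellWeilRank) :
    PAdicOrderV2.PAdicOrderThesisR2 := by
  intro W _ _
  obtain ⟨p, hp, -, hord, N, hN, f, hf, han, hmw⟩ := hX W
  exact ⟨p, hp, hord, N, hN, f, hf, han, hmw⟩

/-- **`X ⟸ LeadingTerm`, stub-level reading.** `PinchPrime ∧ SqueezeUBR2 ∧ Consistency` give the three
open obligations of line `Sketch` in positive analytic rank at ONE prime: the pinch prime is a witness for
the (`∃f`-form of the) one-prime upper bound, and the lower bound holds for all elliptic `W`; recorded as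
one conjunction for the planners. [folklore] -/
theorem sandwich_obligations_of_leadingTerm (hC : LeadingTerm.Consistency) (hP : LeadingTerm.PinchPrime)
    (hUB : LeadingTerm.SqueezeUBR2) :
    (∀ (W : WeierstrassCurve ℚ) [W.IsElliptic] [W.IsGloballyMinimal],
      ∃ (p : ℕ) (_ : Fact p.Prime), 5 ≤ p ∧ IsOrdinaryAt W p ∧
        ∃ (N : ℕ) (_ : NeZero N) (f : CuspForm (Gamma0 N) 2), IsNewformOf W f ∧
          (padicLFunction f (unitRoot W p : ℚ_[p])).order ≤ (W.analyticRank : ℕ∞)) ∧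
    (∀ (W : WeierstrassCurve ℚ) [W.IsElliptic], W.analyticRank ≤ W.mordellWeilRank) :=
  ⟨fun W _ _ ↦ exists_onePrimeUB_of_pinchPrime_of_UB hP hUB W,
    fun W _ ↦ analyticRank_le_mordellWeilRank_of_leadingTerm hC hP W⟩

end Summit.BirchSwinnertonDyer.BirchSwinnertonDyer.Cruxes.PAdicOrderThesisR2.KatoSandwich
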